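import Summits.PneNP.PneNP.Theorems.ChebyshevTracialDesignHSymmetricAmplitudeOne
import HarnessLib

/-!
# Cell pnp-psdrank, route `ChebyshevTracialDesign`: (CG_1′) and the 𝒜₁ rung are LINEAR IN THE MASK — nonnegative mixtures of balanced-block statistics
# are priced — brick 149 (crux `TracialDecayExp20`, stmt-PneNP-19878)

Brick 149 (prover g29; MEMO-32 §8). The pair-containment value `Σ_M Σ_U W(U,M) f(U) C_{c_M}(U)²` and the 𝒜₁ value `Σ_{U,M} W(U,M) f(U) tr(B_UB_UᵀY_M)` are LINEAR
in the mask `f`, and the bounds of bricks 145/146 are uniform in the block `H` and the profile `ψ` (one rate `a`, one threshold `n₀`). Hence they extend,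
with the constant `Σ_i α_i G_i` in place of `G`, to every NONNEGATIVE MIXTURE `f(U) = Σ_i α_i ψ_i(|U∩H_i|)` of balanced-block statistics (`2|H_i| = n`,
`0 ≤ ψ_i ≤ G_i`, `α_i ≥ 0`) — a convex cone of masks that are in general NOT symmetric under any block:
* **`mixture_allDirections_le`** — `Σ_M Σ_U W·(Σ_i α_iψ_i(|U∩H_i|))·C_{c_M}² ≤ 7·10⁶·(Σ_i α_iG_i)·n⁶·(e^{−a·dq n} + 2^{−⌊n/40⌋})` for every pair-symmetric field `|c_M| ≤ 1`;
* **`mixture_amplitudeOne_le`** — `Σ_{U,M} W·(Σ_i α_iψ_i(|U∩H_i|))·tr(B_UB_UᵀY_M) ≤ 6·10⁷·(Σ_i α_iG_i)·n⁶·(e^{−a·dq n} + 2^{−⌊n/40⌋} + √P_{dq n−4})·r`.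
READING: SUMS of one-block statistics over different balanced blocks are priced (all directions / every dimension); PRODUCTS (multi-block statistics
`Ψ(|U∩H₁|,…,|U∩H_k|)`) are not — for those brick 148 reduces the problem to the colour-type-constant directions, whose price is open for `k ≥ 3`.
WHAT THIS FILE DOES NOT DO: products of block statistics, spread masks; anything on `TracialDecayExp20` itself, psd rank of P_PM(K_n), or P vs NP.
[cite: Rothvoss2017, §2 and Lemma 7 (PDF pp. 5–8)] [cite: GriblingDelaatLaurent2019, §5] [cite: KeevashLifshitz2023, Thm. 1.8]
Stature: support/instrument (kernel lane, no defs, axioms standard). Supports stmt-PneNP-19878.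
-/

set_option linter.dupNamespace false -- `Summit.PneNP.PneNP.…`: summit = sub-problem (D-0017)

noncomputable section

namespace Summit.PneNP.PneNP.Theorems.ChebyshevTracialDesignMaskMixtures

open Finset Matrix Literature.Barriers.PneNP Literature.Combinatorics.Optimization
open Summit.PneNP.PneNP.Theorems.ChebyshevTracialDesignAllDirections (allDirections_designValue_le)
open Summit.PneNP.PneNP.Theorems.ChebyshevTracialDesignHSymmetricAmplitudeOne (hSymmetric_amplitudeOne_value_le)

variable {n : ℕ}

/-- **(CG_1′) for nonnegative mixtures of balanced-block statistics, all directions.** [cite: Rothvoss2017, §2 and Lemma 7 (PDF pp. 5–8)]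
[cite: KeevashLifshitz2023, Thm. 1.8] -/
theorem mixture_allDirections_le :
    ∃ a : ℝ, 0 < a ∧ ∃ n₀ : ℕ, ∀ n : ℕ, n₀ ≤ n → Even n → ∀ {t : ℕ} {C : Finset ℕ} {w : ℕ → ℝ},
    IsBalancedDesign n t (Tq n) (dq n) 20 C w →
    ∀ {m : ℕ} (H : Fin m → Finset (Fin n)), (∀ i, 2 * (H i).card = n) →
    ∀ (ψ : Fin m → ℤ → ℝ) (G α : Fin m → ℝ), (∀ i, 0 ≤ G i) → (∀ i, 0 ≤ α i) → (∀ i x, 0 ≤ ψ i x) → (∀ i x, ψ i x ≤ G i) →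
    ∀ (c : PMatch n → Fin n → ℝ), (∀ M p, |c M p| ≤ 1) → (∀ M p, c M (M.2.partner p) = c M p) →
    ∑ M : PMatch n, ∑ U : OddSet n, levelWeight n t C w U M *
        ((∑ i, α i * ψ i (((U.1 ∩ H i).card : ℤ))) *
          (∑ p : Fin n, c M p * ((if p ∈ U.1 then (1 : ℝ) else 0) * (if M.2.partner p ∈ U.1 then (1 : ℝ) else 0))) ^ 2) ≤
      7 * 10 ^ 6 * (∑ i, α i * G i) * (n : ℝ) ^ 6 * (Real.exp (-(a * dq n)) + (1 / 2 : ℝ) ^ (n / 40)) := by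
  obtain ⟨a, ha, n₀, h145⟩ := allDirections_designValue_le
  refine ⟨a, ha, n₀, ?_⟩
  intro n hn hev t C w hdes m H hH ψ G α hG hα hψ0 hψG c hc hcπ
  -- linearity in the mask
  have hlin : ∑ M : PMatch n, ∑ U : OddSet n, levelWeight n t C w U M *
      ((∑ i, α i * ψ i (((U.1 ∩ H i).card : ℤ))) *
        (∑ p : Fin n, c M p * ((if p ∈ U.1 then (1 : ℝ) else 0) * (if M.2.partner p ∈ U.1 then (1 : ℝ) else 0))) ^ 2) =
      ∑ i, α i * ∑ M : PMatch n, ∑ U : OddSet n, levelWeight n t C w U M *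
        (ψ i (((U.1 ∩ H i).card : ℤ)) *
          (∑ p : Fin n, c M p * ((if p ∈ U.1 then (1 : ℝ) else 0) * (if M.2.partner p ∈ U.1 then (1 : ℝ) else 0))) ^ 2) := by
    have h1 : ∀ (M : PMatch n) (U : OddSet n), levelWeight n t C w U M *
        ((∑ i, α i * ψ i (((U.1 ∩ H i).card : ℤ))) *
          (∑ p : Fin n, c M p * ((if p ∈ U.1 then (1 : ℝ) else 0) * (if M.2.partner p ∈ U.1 then (1 : ℝ) else 0))) ^ 2) =
        ∑ i, α i * (levelWeight n t C w U M * (ψ i (((U.1 ∩ H i).card : ℤ)) *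
          (∑ p : Fin n, c M p * ((if p ∈ U.1 then (1 : ℝ) else 0) * (if M.2.partner p ∈ U.1 then (1 : ℝ) else 0))) ^ 2)) := by
      intro M U; rw [Finset.sum_mul, Finset.mul_sum]; exact sum_congr rfl fun i _ => by ring
    simp only [h1]
    simp only [Finset.mul_sum]
    conv_rhs => rw [Finset.sum_comm]
    exact sum_congr rfl fun M _ => Finset.sum_comm
  rw [hlin]
  calc ∑ i, α i * ∑ M : PMatch n, ∑ U : OddSet n, levelWeight n t C w U M *
        (ψ i (((U.1 ∩ H i).card : ℤ)) *
          (∑ p : Fin n, c M p * ((if p ∈ U.1 then (1 : ℝ) else 0) * (if M.2.partner p ∈ U.1 then (1 : ℝ) else 0))) ^ 2)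
      ≤ ∑ i, α i * (7 * 10 ^ 6 * G i * (n : ℝ) ^ 6 * (Real.exp (-(a * dq n)) + (1 / 2 : ℝ) ^ (n / 40))) :=
        sum_le_sum fun i _ => mul_le_mul_of_nonneg_left
          (h145 n hn hev hdes (H i) (hH i) (ψ i) (hG i) (hψ0 i) (hψG i) c hc hcπ) (hα i)
    _ = 7 * 10 ^ 6 * (∑ i, α i * G i) * (n : ℝ) ^ 6 * (Real.exp (-(a * dq n)) + (1 / 2 : ℝ) ^ (n / 40)) := by
        rw [Finset.mul_sum, Finset.sum_mul, Finset.sum_mul]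
        refine sum_congr rfl fun i _ => ?_; ring

/-- **The 𝒜₁ rung for nonnegative mixtures of balanced-block amplitudes, every dimension.** [cite: GriblingDelaatLaurent2019, §5]
[cite: Rothvoss2017, §2 and Lemma 7 (PDF pp. 5–8)] [cite: KeevashLifshitz2023, Thm. 1.8] -/
theorem mixture_amplitudeOne_le :
    ∃ a : ℝ, 0 < a ∧ ∃ n₀ : ℕ, ∀ n : ℕ, n₀ ≤ n → Even n → ∀ {t : ℕ} {C : Finset ℕ} {w : ℕ → ℝ},
    IsBalancedDesign n t (Tq n) (dq n) 20 C w →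
    ∀ {m : ℕ} (H : Fin m → Finset (Fin n)), (∀ i, 2 * (H i).card = n) →
    ∀ (ψ : Fin m → ℤ → ℝ) (G α : Fin m → ℝ), (∀ i, 0 ≤ G i) → (∀ i, 0 ≤ α i) → (∀ i x, 0 ≤ ψ i x) → (∀ i x, ψ i x ≤ G i) →
    ∀ {r d : ℕ} (β : Fin n → Matrix (Fin r) (Fin d) ℝ),
    (∀ U : OddSet n, U.1.card = t →
      (1 - (∑ p, (if p ∈ U.1 then (1 : ℝ) else 0) • β p) * (∑ p, (if p ∈ U.1 then (1 : ℝ) else 0) • β p)ᵀ).PosSemidef) →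
    ∀ (Y : PMatch n → Matrix (Fin r) (Fin r) ℝ), (∀ M, (Y M).PosSemidef ∧ (1 - Y M).PosSemidef) →
    ∑ U : OddSet n, ∑ M : PMatch n, levelWeight n t C w U M *
        ((∑ i, α i * ψ i (((U.1 ∩ H i).card : ℤ))) *
          ((∑ p, (if p ∈ U.1 then (1 : ℝ) else 0) • β p) * (∑ p, (if p ∈ U.1 then (1 : ℝ) else 0) • β p)ᵀ * Y M).trace) ≤
      6 * 10 ^ 7 * (∑ i, α i * G i) * (n : ℝ) ^ 6 * (Real.exp (-(a * dq n)) + (1 / 2 : ℝ) ^ (n / 40) +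
        Real.sqrt (∏ i ∈ range ((dq n - 4) / 2 + 1), ((2 * i + 1 : ℝ) / ((n : ℝ) - 2 * i)))) * r := by
  obtain ⟨a, ha, n₀, h146⟩ := hSymmetric_amplitudeOne_value_le
  refine ⟨a, ha, n₀, ?_⟩
  intro n hn hev t C w hdes m H hH ψ G α hG hα hψ0 hψG r d β hB Y hY
  have hlin : ∑ U : OddSet n, ∑ M : PMatch n, levelWeight n t C w U M *
        ((∑ i, α i * ψ i (((U.1 ∩ H i).card : ℤ))) *
          ((∑ p, (if p ∈ U.1 then (1 : ℝ) else 0) • β p) * (∑ p, (if p ∈ U.1 then (1 : ℝ) else 0) • β p)ᵀ * Y M).trace) =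
      ∑ i, α i * ∑ U : OddSet n, ∑ M : PMatch n, levelWeight n t C w U M *
        (ψ i (((U.1 ∩ H i).card : ℤ)) *
          ((∑ p, (if p ∈ U.1 then (1 : ℝ) else 0) • β p) * (∑ p, (if p ∈ U.1 then (1 : ℝ) else 0) • β p)ᵀ * Y M).trace) := by
    have h1 : ∀ (U : OddSet n) (M : PMatch n), levelWeight n t C w U M *
        ((∑ i, α i * ψ i (((U.1 ∩ H i).card : ℤ))) *
          ((∑ p, (if p ∈ U.1 then (1 : ℝ) else 0) • β p) * (∑ p, (if p ∈ U.1 then (1 : ℝ) else 0) • β p)ᵀ * Y M).trace) =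
        ∑ i, α i * (levelWeight n t C w U M * (ψ i (((U.1 ∩ H i).card : ℤ)) *
          ((∑ p, (if p ∈ U.1 then (1 : ℝ) else 0) • β p) * (∑ p, (if p ∈ U.1 then (1 : ℝ) else 0) • β p)ᵀ * Y M).trace)) := by
      intro U M; rw [Finset.sum_mul, Finset.mul_sum]; exact sum_congr rfl fun i _ => by ring
    simp only [h1]
    simp only [Finset.mul_sum]
    conv_rhs => rw [Finset.sum_comm]
    exact sum_congr rfl fun U _ => Finset.sum_comm
  rw [hlin]
  calc ∑ i, α i * ∑ U : OddSet n, ∑ M : PMatch n, levelWeight n t C w U M *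
        (ψ i (((U.1 ∩ H i).card : ℤ)) *
          ((∑ p, (if p ∈ U.1 then (1 : ℝ) else 0) • β p) * (∑ p, (if p ∈ U.1 then (1 : ℝ) else 0) • β p)ᵀ * Y M).trace)
      ≤ ∑ i, α i * (6 * 10 ^ 7 * G i * (n : ℝ) ^ 6 * (Real.exp (-(a * dq n)) + (1 / 2 : ℝ) ^ (n / 40) +
          Real.sqrt (∏ i ∈ range ((dq n - 4) / 2 + 1), ((2 * i + 1 : ℝ) / ((n : ℝ) - 2 * i)))) * r) :=
        sum_le_sum fun i _ => mul_le_mul_of_nonneg_left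
          (h146 n hn hev hdes (H i) (hH i) (ψ i) (hG i) (hψ0 i) (hψG i) β hB Y hY) (hα i)
    _ = _ := by
        rw [Finset.mul_sum, Finset.sum_mul, Finset.sum_mul, Finset.sum_mul]
        refine sum_congr rfl fun i _ => ?_; ring

end Summit.PneNP.PneNP.Theorems.ChebyshevTracialDesignMaskMixtures

end
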